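import Literature.FieldTheory.FunctionField.RationalPolynomialFixingGroup
import Mathlib.RingTheory.RootsOfUnity.PrimitiveRoots
import HarnessLib

/-!
# The fixing group of `uⁿ` is the group of `n`-th roots of unity: `G(uⁿ) = {u ↦ ζu : ζⁿ = 1} ≅ μₙ(K)`, and
# `K(u)/K(uⁿ)` is Galois iff `K` contains a primitive `n`-th root of unity (Gutierrez–Sevilla 2008 Thm 9 (iii), Thm 7 (ii))

Topic `Literature/FieldTheory/FunctionField`; namespace `Literature.FieldTheory.FunctionField`.  THEOREMS ONLY
(no definition, no named fact, no instance, no notation; net Literature debt 0).  Sequel BY IMPORT of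
`RationalPolynomialFixingGroup` (the fixing group of a polynomial is affine:
`exists_affine_comp_eq_of_mem_fixingSubgroup_adjoin_algebraMap`, `mem_fixingSubgroup_adjoin_algebraMap_iff_comp_eq`),
`RationalFixingGroup` (`card_fixingSubgroup_adjoin_eq_iff_isGalois`, `algEquiv_ext_of_apply_X_eq`,
`finite_fixingSubgroup_adjoin`), `RationalAffineFixingGroup` (`exists_algEquiv_apply_X_eq_affine`), `X_pow_ne_C`,
`max_natDegree_X_pow` (`RationalSeparableClosure`), and Mathlib's `rootsOfUnity` (`card_rootsOfUnity_eq_iff_exists_isPrimitiveRoot`,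
`mem_rootsOfUnity_prime_pow_mul_iff`, `rootsOfUnity_one`) — REUSED, nothing restated.  The tree's worked example
`coe_fixingSubgroup_adjoin_X_sq` / `fixingSubgroup_adjoin_X_sq_eq_bot_of_charTwo` (`n = 2`) is the special case `n = 2`.

## Sources, VERBATIM

J. Gutierrez, D. Sevilla [GutierrezSevilla2008] (held `paper:arxiv-0804.1687`), §3 Theorem 9 «Let `f ∈ K(x)` of degree
`m` in normal form and `u = (ax + b)/(cx + d)` such that `f ∘ u = f`. […] (iii) If `c = 0` (that is, we take
`u = ax + b`), then `f_N(b) = 0` and `a^m = 1`. (iv) If `c ≠ 0` then `f_D(a/c) = 0`.» — for `f = x^m` (normal form: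
`f_N = x^m`, `f_D = 1`) this says exactly: `G(x^m) ⊆ {ax : a^m = 1}`; algorithm step B «Compute `A = {α ∈ K : α^m = 1}`»;
Theorem 7 «(i) For any non-constant `f ∈ K(x)`, `|G(f)|` divides `deg f`. […] (ii) If `|G(f)| = deg f` then
`K(f) ⊆ K(x)` is normal. Moreover, if the extension `K(f) ⊆ K(x)` is separable, then `K(f) ⊆ K(x)` is normal ⇒
`|G(f)| = deg f`.»; p0005 «unfortunately, it is not true in general that `[K(x) : K(f)] = |G(f)|`».
J. Gutierrez, D. Sevilla [GutierrezSevilla2006] (held `paper:arxiv-0803.3976`), §3 Theorem 14 (ii)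
«`|G(f)| = deg f ⇒ K(f) ⊆ K(x)` is normal.»

## What is proved (`K` ANY field, `n ≥ 1`; `Γ = RatFunc K ≃ₐ[K] RatFunc K`, `G(f) = (K(f)).fixingSubgroup`, `u = RatFunc.X`)

* `X_pow_comp_affine_eq_iff` (`uⁿ ∘ (au + b) = uⁿ ⟺ aⁿ = 1 ∧ b = 0` — Theorem 9 (iii) for `f = xⁿ`, with converse),
  **`coe_fixingSubgroup_adjoin_X_pow`** (`G(uⁿ) = {σ : σ(u) = ζu, ζⁿ = 1}` EXACTLY),
  **`exists_mulEquiv_fixingSubgroup_adjoin_X_pow_rootsOfUnity`** (`G(uⁿ) ≃* rootsOfUnity n K`, `σ ↦ ζ_σ`),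
  **`card_fixingSubgroup_adjoin_X_pow`** (`|G(uⁿ)| = |μₙ(K)|`), **`isGalois_adjoin_X_pow_iff`** (`K(u)/K(uⁿ)` is Galois
  iff `K` has a primitive `n`-th root of unity — Theorem 7 (ii) made explicit for `uⁿ`),
  `card_fixingSubgroup_adjoin_X_pow_prime_pow_mul` (exponential characteristic `p`: `|G(u^{pᵏm})| = |μₘ(K)|`),
  **`fixingSubgroup_adjoin_X_pow_prime_pow_eq_bot`** (characteristic `p`: `G(u^{pᵏ}) = 1`, though `deg = pᵏ` — «it is
  not true in general that `[K(x) : K(f)] = |G(f)|`»).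
-/

noncomputable section

open Polynomial IntermediateField

namespace Literature.FieldTheory.FunctionField

variable {K : Type*} [Field K]

section Monomial

/-- **Theorem 9 (iii) for `f = xⁿ`** (normal form: `f_N = xⁿ`): `xⁿ ∘ (ax + b) = xⁿ` iff `aⁿ = 1` («`a^m = 1`») and
`b = 0` («`f_N(b) = 0`»); here with the converse, `n ≥ 1`. [cite: GutierrezSevilla2008, §3 Thm 9 (iii)] -/
theorem X_pow_comp_affine_eq_iff {n : ℕ} (hn : n ≠ 0) (a b : K) :
    (X ^ n : K[X]).comp (C a * X + C b) = X ^ n ↔ a ^ n = 1 ∧ b = 0 := by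
  constructor
  · intro h
    have hb : b = 0 := by
      have h0 := congrArg (eval 0) h
      rw [eval_comp, eval_add, eval_mul, eval_C, eval_X, mul_zero, zero_add, eval_C, eval_pow, eval_X,
        eval_pow, eval_X, zero_pow hn] at h0
      exact pow_eq_zero_iff hn |>.mp h0
    subst hb
    refine ⟨?_, rfl⟩
    rw [map_zero, add_zero] at h
    have h1 := congrArg (eval 1) h
    rwa [eval_comp, eval_mul, eval_C, eval_X, mul_one, eval_pow, eval_X, eval_pow, eval_X, one_pow] at h1
  · rintro ⟨ha, rfl⟩
    rw [map_zero, add_zero, X_pow_comp, mul_pow, ← C_pow, ha, C_1, one_mul]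

/-- **`G(uⁿ) = {u ↦ ζu : ζⁿ = 1}`** EXACTLY, over every field (`n ≥ 1`): `⊆` by Theorem 9 (iii)–(iv) (the fixing
group of a polynomial is affine, `RationalPolynomialFixingGroup`), `⊇` because `(ζu)ⁿ = uⁿ`.
[cite: GutierrezSevilla2008, §3 Thm 9 (iii)–(iv), algorithm step B–C] -/
theorem coe_fixingSubgroup_adjoin_X_pow {n : ℕ} (hn : n ≠ 0) :
    ((IntermediateField.adjoin K ({(RatFunc.X : RatFunc K) ^ n} : Set (RatFunc K))).fixingSubgroup :
        Set (RatFunc K ≃ₐ[K] RatFunc K)) =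
      {σ | ∃ ζ : K, ζ ^ n = 1 ∧ σ RatFunc.X = RatFunc.C ζ * RatFunc.X} := by
  have hF : (X ^ n : K[X]).natDegree ≠ 0 := by rwa [natDegree_X_pow]
  have hζX : ∀ ζ : K, RatFunc.C ζ * RatFunc.X = algebraMap K[X] (RatFunc K) (C ζ * X + C 0) := fun ζ => by
    rw [map_zero, add_zero, map_mul, RatFunc.algebraMap_C, RatFunc.algebraMap_X]
  ext σ
  simp only [SetLike.mem_coe, Set.mem_setOf_eq]
  rw [show (RatFunc.X : RatFunc K) ^ n = algebraMap K[X] (RatFunc K) (X ^ n) by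
    rw [map_pow, RatFunc.algebraMap_X]]
  constructor
  · intro hσ
    obtain ⟨a, b, _, hσX, hcomp, -, -⟩ := exists_affine_comp_eq_of_mem_fixingSubgroup_adjoin_algebraMap hF hσ
    obtain ⟨ha, rfl⟩ := (X_pow_comp_affine_eq_iff hn a b).mp hcomp
    exact ⟨a, ha, by rw [hσX, hζX]⟩
  · rintro ⟨ζ, hζ, hσX⟩
    rw [hζX] at hσX
    exact (mem_fixingSubgroup_adjoin_algebraMap_iff_comp_eq hσX _).mpr
      ((X_pow_comp_affine_eq_iff hn ζ 0).mpr ⟨hζ, rfl⟩)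

/-- The multiplier `ζ` in `σ(u) = ζu` is determined by `σ`. [cite: GutierrezSevilla2008, §3 Thm 9 (iii)] -/
theorem C_mul_X_injective : Function.Injective fun ζ : K => RatFunc.C ζ * (RatFunc.X : RatFunc K) := by
  intro ζ ζ' h
  have h' := mul_right_cancel₀ RatFunc.X_ne_zero h
  exact RatFunc.C_injective h'

/-- `σ(c) = c` for constants `c ∈ K`, spelled with `RatFunc.C` (`Γ` acts `K`-linearly). [cite: GutierrezSevilla2008, §3 Def. 4 (Γ = Aut_K K(x))] -/
theorem algEquiv_apply_ratFuncC (φ : RatFunc K ≃ₐ[K] RatFunc K) (c : K) : φ (RatFunc.C c) = RatFunc.C c := by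
  have h := φ.commutes c
  rwa [RatFunc.algebraMap_eq_C] at h

/-- **`G(uⁿ) ≅ μₙ(K)`**: `σ ↦ ζ_σ` (`σ(u) = ζ_σ u`) is a group isomorphism of `G(uⁿ)` onto the `n`-th roots of unity of
`K` (a homomorphism because `(στ)(u) = σ(ζ_τ u) = ζ_τ ζ_σ u`; bijective by `coe_fixingSubgroup_adjoin_X_pow` and
`σ ↦ σ(u)` injective). [cite: GutierrezSevilla2008, §3 Thm 9 (iii), algorithm steps B–C (A = {α : α^m = 1})] -/
theorem exists_mulEquiv_fixingSubgroup_adjoin_X_pow_rootsOfUnity {n : ℕ} (hn : n ≠ 0) :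
    ∃ e : (IntermediateField.adjoin K ({(RatFunc.X : RatFunc K) ^ n} : Set (RatFunc K))).fixingSubgroup ≃*
        rootsOfUnity n K,
      ∀ σ : (IntermediateField.adjoin K ({(RatFunc.X : RatFunc K) ^ n} : Set (RatFunc K))).fixingSubgroup,
        (σ : RatFunc K ≃ₐ[K] RatFunc K) RatFunc.X = RatFunc.C ((e σ : Kˣ) : K) * RatFunc.X := by
  haveI : NeZero n := ⟨hn⟩
  have hmem : ∀ σ : (IntermediateField.adjoin K ({(RatFunc.X : RatFunc K) ^ n} : Set (RatFunc K))).fixingSubgroup,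
      ∃ ζ : K, ζ ^ n = 1 ∧ (σ : RatFunc K ≃ₐ[K] RatFunc K) RatFunc.X = RatFunc.C ζ * RatFunc.X := by
    intro σ
    have h : (σ : RatFunc K ≃ₐ[K] RatFunc K) ∈
        ((IntermediateField.adjoin K ({(RatFunc.X : RatFunc K) ^ n} : Set (RatFunc K))).fixingSubgroup :
          Set (RatFunc K ≃ₐ[K] RatFunc K)) := σ.2
    rwa [coe_fixingSubgroup_adjoin_X_pow hn] at h
  choose ζ hζ hσζ using hmem
  -- the map `σ ↦ ζ_σ` is a homomorphism
  let f : (IntermediateField.adjoin K ({(RatFunc.X : RatFunc K) ^ n} : Set (RatFunc K))).fixingSubgroup →*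
      rootsOfUnity n K :=
    { toFun := fun σ => rootsOfUnity.mkOfPowEq (ζ σ) (hζ σ)
      map_one' := by
        apply Subtype.ext; apply Units.ext
        rw [rootsOfUnity.coe_mkOfPowEq, OneMemClass.coe_one, Units.val_one]
        apply C_mul_X_injective
        simp only
        rw [← hσζ 1, map_one, one_mul]
        rfl
      map_mul' := fun σ τ => by
        apply Subtype.ext; apply Units.ext
        rw [rootsOfUnity.coe_mkOfPowEq, Subgroup.coe_mul, Units.val_mul, rootsOfUnity.coe_mkOfPowEq,
          rootsOfUnity.coe_mkOfPowEq]
        apply C_mul_X_injective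
        simp only
        rw [← hσζ (σ * τ), Subgroup.coe_mul, AlgEquiv.mul_apply, hσζ τ, map_mul, hσζ σ, algEquiv_apply_ratFuncC,
          map_mul]
        ring }
  have hf : ∀ σ, ((f σ : Kˣ) : K) = ζ σ := fun σ => rfl
  refine ⟨MulEquiv.ofBijective f ⟨fun σ τ h => ?_, fun ξ => ?_⟩, fun σ => ?_⟩
  · apply Subtype.ext
    apply algEquiv_ext_of_apply_X_eq
    rw [hσζ σ, hσζ τ, ← hf σ, ← hf τ, h]
  · obtain ⟨σ, hσ⟩ := exists_algEquiv_apply_X_eq_affine (Units.ne_zero (ξ : Kˣ)) (0 : K)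
    rw [map_zero, add_zero, map_mul, RatFunc.algebraMap_C, RatFunc.algebraMap_X] at hσ
    have hσG : σ ∈ (IntermediateField.adjoin K ({(RatFunc.X : RatFunc K) ^ n} : Set (RatFunc K))).fixingSubgroup := by
      show σ ∈ ((IntermediateField.adjoin K ({(RatFunc.X : RatFunc K) ^ n} : Set (RatFunc K))).fixingSubgroup :
        Set (RatFunc K ≃ₐ[K] RatFunc K))
      rw [coe_fixingSubgroup_adjoin_X_pow hn]
      exact ⟨_, (mem_rootsOfUnity' n _).mp ξ.2, hσ⟩
    refine ⟨⟨σ, hσG⟩, ?_⟩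
    apply Subtype.ext; apply Units.ext
    rw [hf]
    apply C_mul_X_injective
    simp only
    rw [← hσζ ⟨σ, hσG⟩]
    exact hσ
  · rw [MulEquiv.ofBijective_apply, hf]
    exact hσζ σ

/-- **`|G(uⁿ)| = |μₙ(K)|`**, the number of `n`-th roots of unity in `K` (so `|G(uⁿ)| ∣ n = deg uⁿ`, Theorem 7 (i),
with equality iff `μₙ(K)` is full). [cite: GutierrezSevilla2008, §3 Thm 7 (i), Thm 9 (iii)] -/
theorem card_fixingSubgroup_adjoin_X_pow {n : ℕ} (hn : n ≠ 0) :
    Nat.card (IntermediateField.adjoin K ({(RatFunc.X : RatFunc K) ^ n} : Set (RatFunc K))).fixingSubgroup =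
      Nat.card (rootsOfUnity n K) := by
  obtain ⟨e, -⟩ := exists_mulEquiv_fixingSubgroup_adjoin_X_pow_rootsOfUnity (K := K) hn
  exact Nat.card_congr e.toEquiv

/-- **`K(u)/K(uⁿ)` is Galois iff `K` contains a primitive `n`-th root of unity** (`n ≥ 1`): Theorem 7 (ii)
«`|G(f)| = deg f` ⟺ normal (separable case)» in the tree's form `card_fixingSubgroup_adjoin_eq_iff_isGalois`, with
`|G(uⁿ)| = |μₙ(K)|` and `deg uⁿ = n`. [cite: GutierrezSevilla2008, §3 Thm 7 (ii)] [cite: GutierrezSevilla2006, §3 Thm 14 (ii)] -/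
theorem isGalois_adjoin_X_pow_iff {n : ℕ} (hn : n ≠ 0) :
    IsGalois (IntermediateField.adjoin K ({(RatFunc.X : RatFunc K) ^ n} : Set (RatFunc K))) (RatFunc K) ↔
      ∃ ζ : K, IsPrimitiveRoot ζ n := by
  haveI : NeZero n := ⟨hn⟩
  rw [← card_fixingSubgroup_adjoin_eq_iff_isGalois (X_pow_ne_C hn), card_fixingSubgroup_adjoin_X_pow hn,
    max_natDegree_X_pow, card_rootsOfUnity_eq_iff_exists_isPrimitiveRoot]

/-- In exponential characteristic `p`: **`|G(u^{pᵏm})| = |μₘ(K)|`** — the `p`-part of the exponent contributes no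
automorphisms (`ζ^{pᵏm} = 1 ⟺ ζ^m = 1`). [cite: GutierrezSevilla2008, §3 Thm 7 (ii) («if the extension is separable»), Thm 9 (iii)] -/
theorem card_fixingSubgroup_adjoin_X_pow_prime_pow_mul (p k m : ℕ) [ExpChar K p] (hm : m ≠ 0) :
    Nat.card (IntermediateField.adjoin K ({(RatFunc.X : RatFunc K) ^ (p ^ k * m)} : Set (RatFunc K))).fixingSubgroup =
      Nat.card (rootsOfUnity m K) := by
  have hp : p ≠ 0 := (expChar_pos K p).ne'
  rw [card_fixingSubgroup_adjoin_X_pow (mul_ne_zero (pow_ne_zero k hp) hm)]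
  have h : rootsOfUnity (p ^ k * m) K = rootsOfUnity m K :=
    Subgroup.ext fun ζ => mem_rootsOfUnity_prime_pow_mul_iff K p k m
  rw [h]

/-- In characteristic `p`, **`G(u^{pᵏ})` is trivial** although `deg u^{pᵏ} = pᵏ` («it is not true in general that
`[K(x) : K(f)] = |G(f)|`»; the tree's `fixingSubgroup_adjoin_X_sq_eq_bot_of_charTwo` is `pᵏ = 2`).
[cite: GutierrezSevilla2008, §3 Thm 7 (ii), p0005] -/
theorem fixingSubgroup_adjoin_X_pow_prime_pow_eq_bot (p k : ℕ) [hp : Fact p.Prime] [CharP K p] :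
    (IntermediateField.adjoin K ({(RatFunc.X : RatFunc K) ^ (p ^ k)} : Set (RatFunc K))).fixingSubgroup = ⊥ := by
  have h := card_fixingSubgroup_adjoin_X_pow_prime_pow_mul (K := K) p k 1 one_ne_zero
  rw [mul_one] at h
  have h1 : Nat.card (rootsOfUnity 1 K) = 1 := by
    rw [rootsOfUnity_one]; exact Nat.card_unique
  rw [h1] at h
  haveI := finite_fixingSubgroup_adjoin (X_pow_ne_C (K := K) (pow_ne_zero k hp.out.ne_zero))
  exact (Subgroup.eq_bot_iff_card _).mpr h

end Monomial

end Literature.FieldTheory.FunctionField
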